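import Literature.Computability.Cryptography.GapSVPToSISParameters
import HarnessLib

/-!
# MR07 Thm. 5.23 with the machine-decidable verifier: the polynomial parameter choice makes the NO-case error eventually small — proved

Topic `Computability/Cryptography` (family `pqc`). Theorems only (real analysis). Sequel of
`GapSVPToSISParameters.lean` for the idealised reduction with the distance-to-`ℤ` test (b′) in place of
the cosine test (b) (`MRGapCVPIdealisedZ.toReal_reductionZ_false_le`, the form a Turing machine decides):
its NO-case error is
`(T+1)(1−p)^{k₀} + N(1 − (δ′ − mε′))^k + e^{−32Nδ_H²} + e^{−N/K⁴}(4√nK²)ⁿ + N·m(1+ε)/(1−ε)ε`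
(`ε = 2⁻ⁿ`, `ε′ = 2ε/(1+ε)`, `K = √(nm)`, `p = (δ/(2βm) − mε′)/3`, `δ ≥ δ′ ≥ 1/n^c`, `δ_H > 0` the
Hoeffding slack of test (b′)), i.e. the bound of `GapSVPToSISParameters` with the Hoeffding term
`e^{−N(1/2−2ε)²/2}` replaced by `e^{−32Nδ_H²}`. With the same polynomial parameters (`N = n⁴m³`,
`k = n^{c+1}`, `k₀ = 24⌈β⌉mn^{c+1}`) the total is eventually `≤ η`:

* `MicciancioRegev2007.eventually_exp_neg_mul_le` — `e^{−a·n⁴m³} ≤ η` eventually, for `a > 0`;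
* `MicciancioRegev2007.eventually_total_errorZ_le` — the statement above;
* `MicciancioRegev2007.thresholdZ_b_le` — the admissibility of the machine's threshold of test (b′):
  for `n ≥ 8`, `3/80 ≤ (1 − 2·2⁻ⁿ)/(2π²) − 1/80` (so `θ_b = 3/80`, `δ_H = 1/80` qualify).

## References

* D. Micciancio, O. Regev, *Worst-case to average-case reductions based on Gaussian measures*,
  SIAM J. Comput. 37 (2007) 267–302; authors' version, Thm. 5.23 and its proof, pp. 28–31.
* D. Aharonov, O. Regev, *Lattice problems in NP ∩ coNP*, J. ACM 52 (2005) 749–765, §6.1 (the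
  distance-to-`ℤ` form of the test).
-/

noncomputable section

open Filter Topology Literature.Algebra.EuclideanLattices

namespace Literature.Computability.Cryptography

namespace MicciancioRegev2007

open LWE LWE.RegevReduction

/-- For `a > 0` and `m ≥ 1`, `e^{−a n⁴ m³} ≤ η` for all sufficiently large `n` (`η > 0`). [folklore] -/
theorem eventually_exp_neg_mul_le {m : ℕ → ℕ} (hm1 : ∀ n, 1 ≤ m n) {a η : ℝ} (ha : 0 < a) (hη : 0 < η) :
    ∀ᶠ n : ℕ in atTop, Real.exp (-(a * (((n ^ 4 * m n ^ 3 : ℕ)) : ℝ))) ≤ η := by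
  have ht : Tendsto (fun n : ℕ => Real.exp (-(a * n))) atTop (𝓝 0) :=
    Real.tendsto_exp_atBot.comp
      (tendsto_neg_atTop_atBot.comp (tendsto_natCast_atTop_atTop.const_mul_atTop ha))
  filter_upwards [ht.eventually (ge_mem_nhds hη), eventually_ge_atTop 1] with n hn hn1
  refine le_trans (Real.exp_le_exp.2 ?_) hn
  have h1 : (n : ℝ) ≤ ((n ^ 4 * m n ^ 3 : ℕ) : ℝ) := by
    have h : n ≤ n ^ 4 * m n ^ 3 :=
      calc n = n ^ 1 * 1 := by ring
        _ ≤ n ^ 4 * m n ^ 3 :=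
          Nat.mul_le_mul (Nat.pow_le_pow_right hn1 (by norm_num)) (Nat.one_le_pow _ _ (hm1 n))
    exact_mod_cast h
  nlinarith

/-- **The polynomial parameter choice of MR07 Thm. 5.23 makes the NO-case error of the reduction with
the machine-decidable verifier eventually `≤ η`**: for polynomially bounded `m ≥ 1`, `β ≥ 1`, every `c`,
`η > 0` and Hoeffding slack `δ_H > 0`, eventually in `n`, for all `1/n^c ≤ δ′ ≤ δ ≤ 1` and all `T` with
`T + 1 ≤ 2ⁿ` (`ε = 2⁻ⁿ`, `N = n⁴m³`, `K = √(nm)`, `k = n^{c+1}`, `k₀ = 24⌈β⌉mn^{c+1}`):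
`(T+1)(1 − (δ/(2βm) − mε′)/3)^{k₀} + N(1 − (δ′ − mε′))^k + e^{−32Nδ_H²} + e^{−N/K⁴}(4√nK²)ⁿ +
N·m(1+ε)/(1−ε)ε ≤ η`. [cite: MicciancioRegev2007, Thm. 5.23 (proof, NO case, pp. 29–31) — distance-to-ℤ test] -/
theorem eventually_total_errorZ_le {m : ℕ → ℕ} (hm : IsPolyBounded m) (hm1 : ∀ n, 1 ≤ m n)
    {β : ℕ → ℝ} (hβ : IsPolyBoundedReal β) (hβ1 : ∀ n, 1 ≤ β n) (c : ℕ) {η δH : ℝ} (hη : 0 < η)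
    (hδH : 0 < δH) :
    ∀ᶠ n : ℕ in atTop, ∀ (δ' δ : ℝ), 1 / (n : ℝ) ^ c ≤ δ' → δ' ≤ δ → δ ≤ 1 →
      ∀ T : ℕ, (T + 1 : ℝ) ≤ 2 ^ n →
        (T + 1 : ℝ) * (1 - (1 / 3 : ℝ) * (δ / (2 * β n * m n) -
            m n * (2 * (2⁻¹ : ℝ) ^ n / (1 + (2⁻¹ : ℝ) ^ n)))) ^ (24 * ⌈β n⌉₊ * m n * n ^ (c + 1)) +
          (((n ^ 4 * m n ^ 3 : ℕ) : ℝ) *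
              (1 - (δ' - m n * (2 * (2⁻¹ : ℝ) ^ n / (1 + (2⁻¹ : ℝ) ^ n)))) ^ (n ^ (c + 1)) +
            (Real.exp (-(32 * ((n ^ 4 * m n ^ 3 : ℕ) : ℝ) * δH ^ 2)) +
              (Real.exp (-(((n ^ 4 * m n ^ 3 : ℕ) : ℝ) / Real.sqrt ((n : ℝ) * m n) ^ 4)) *
                  (4 * Real.sqrt n * Real.sqrt ((n : ℝ) * m n) ^ 2) ^ n +
                ((n ^ 4 * m n ^ 3 : ℕ) : ℝ) *
                  (m n * ((1 + (2⁻¹ : ℝ) ^ n) / (1 - (2⁻¹ : ℝ) ^ n) * (2⁻¹ : ℝ) ^ n))))) ≤ η := by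
  have hold := eventually_total_error_le hm hm1 hβ hβ1 c (half_pos hη)
  have hnew := eventually_exp_neg_mul_le hm1 (a := 32 * δH ^ 2) (by positivity) (half_pos hη)
  filter_upwards [hold, hnew] with n holdn hnewn
  intro δ' δ hδ' hδ'δ hδ1 T hT
  have h1 := holdn δ' δ hδ' hδ'δ hδ1 T hT
  have h2 : 0 ≤ Real.exp (-(((n ^ 4 * m n ^ 3 : ℕ) : ℝ) * (1 / 2 - 2 * (2⁻¹ : ℝ) ^ n) ^ 2 / 2)) :=
    (Real.exp_pos _).le
  have h3 : Real.exp (-(32 * ((n ^ 4 * m n ^ 3 : ℕ) : ℝ) * δH ^ 2)) =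
      Real.exp (-(32 * δH ^ 2 * ((n ^ 4 * m n ^ 3 : ℕ) : ℝ))) := by ring_nf
  rw [h3]
  linarith

/-- **Admissibility of the machine's threshold of test (b′)**: for `n ≥ 8`,
`3/80 ≤ (1 − 2·2⁻ⁿ)/(2π²) − 1/80`, i.e. `π²/10 ≤ 1 − 2⁻ⁿ⁺¹` (`π < 3.1416`). So the thresholds
`θ_b = 3/80`, `δ_H = 1/80` satisfy the hypothesis of `MRGapCVPIdealisedZ.toReal_reductionZ_false_le`.
[cite: MicciancioRegev2007, Thm. 5.23 (proof, p. 30, "for all sufficiently large n") — constants of the distance-to-ℤ test] -/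
theorem thresholdZ_b_le {n : ℕ} (hn : 8 ≤ n) :
    (3 / 80 : ℝ) ≤ (1 - 2 * (2⁻¹ : ℝ) ^ n) / (2 * Real.pi ^ 2) - 1 / 80 := by
  have hπ : Real.pi < 3.1416 := Real.pi_lt_d4
  have hπ0 : 0 < Real.pi := Real.pi_pos
  have hε : (2⁻¹ : ℝ) ^ n ≤ (2⁻¹ : ℝ) ^ 8 := pow_le_pow_of_le_one (by norm_num) (by norm_num) hn
  have hπ2 : Real.pi ^ 2 < 3.1416 ^ 2 := by nlinarith
  rw [le_sub_iff_add_le, le_div_iff₀ (by positivity)]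
  norm_num at hε hπ2 ⊢
  nlinarith

end MicciancioRegev2007

end Literature.Computability.Cryptography

end
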